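import Mathlib
import Summits.Ventures.FusionMHD.Models.SAlphaStable58Defs
import HarnessLib

/-!
# STABLE-POINT core at `(1, 29/50)`, piece 0 (`[0, 2]`): kernel-decided Taylor-model leaves ⇒ `F_0 > 0` and `amplitudeResidual 1 (29/50) F_0 F_0″ ≤ 0` on the piece ⇒ `EnergyDominatesOn` for its amplitude phase

LADDER-GRIDFUSION rung F3 («F3.BALLOON-sα-STABLE-POINT-058»: the third point of the stable-side scan at unit shear, 5 % below the shot edge); gridfusion-model-7 g8, 2026-08-28.  Two `decide +kernel` calls (`OpModel.trig.pLeavesCheck`, scale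
`2^60`, Taylor degree 10, 16 leaves of half-width 1/16) and the lane's soundness theorem `OpSem.trig.pos_of_pLeavesCheck`
(Literature/Analysis/ValidatedNumerics/TaylorModelZeroCert); lit-4's `energyDominatesOn_of_amplitude` (BallooningSAlphaStableSide) turns the two
sign facts into energy domination by `amplitudePhase 1 (29/50) F_0 F_0′` on the piece.  MODELLED: `s–α` model; nothing about a device.
No `native_decide`.  Citations: Freidberg 2014 §12.6.2 (12.97) [Freidberg2014]; Makino–Berz 2003 Alg. 2 [MakinoBerz2003]; Hartman 2002 XI.6.2
[Hartman2002].  Everything here is [instance data].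
-/

open Literature.Analysis.ValidatedNumerics Literature.Analysis.ValidatedNumerics.PolyMP
open Literature.Analysis.ValidatedNumerics.NumericsMP Literature.Analysis.ValidatedNumerics.ExpPoly
open Literature.MathematicalPhysics.MHD.Ballooning
open Real Set

namespace Summit.Ventures.FusionMHD.Models

namespace SAlphaStable58

/-- SEMANTICS OF THE PROGRAM: the top register of `e58Prog lf lf2` is `−amplitudeResidual 1 (29/50) (Poly.eval lf) (Poly.eval lf2)`.
[instance data] -/
theorem toFunP_e58Prog (lf lf2 : Poly) (t : ℝ) :
    TProg.toFunP (e58Prog lf lf2) [] t = -SAlpha.amplitudeResidual 1 (29 / 50) (Poly.eval lf) (Poly.eval lf2) t := by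
  unfold SAlpha.amplitudeResidual SAlpha.bending SAlpha.shearParam SAlpha.localShear
  simp [e58Prog, TProg.toFunP, constStack, TProg.runF, TOp.evalF, SOp.evalF, getReg]
  ring

/-- Semantics of `e58PosProg`. [instance data] -/
theorem toFunP_e58PosProg (lf : Poly) (t : ℝ) : TProg.toFunP (e58PosProg lf) [] t = Poly.eval lf t := by
  simp [e58PosProg, TProg.toFunP, constStack, TProg.runF, TOp.evalF, SOp.evalF]

/-- From a kernel-accepted leaf tiling of `[x, y]` for `e58Prog`: the amplitude residual is `≤ 0` on `[x, y]`. [instance data] -/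
theorem e58_residual_nonpos {lf lf2 : Poly} {L : List PLeaf} {x y : ℚ} (hxy : x < y)
    (ht : tiles x (L.map fun l => (l.e, l.k)) y = true)
    (hc : OpModel.trig.pLeavesCheck e58Prm (2 ^ 60) (e58Prog lf lf2) [] L = true)
    {t : ℝ} (h1 : (x : ℝ) ≤ t) (h2 : t ≤ (y : ℝ)) :
    SAlpha.amplitudeResidual 1 (29 / 50) (Poly.eval lf) (Poly.eval lf2) t ≤ 0 := by
  obtain ⟨-, h⟩ := OpSem.trig.pos_of_pLeavesCheck (prm := e58Prm) (S := 2 ^ 60) (by norm_num) boxMem_nil L x y ht hc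
  have h' := h hxy t ⟨h1, h2⟩
  rw [toFunP_trig, toFunP_e58Prog] at h'
  linarith

/-- From a kernel-accepted leaf tiling of `[x, y]` for `e58PosProg`: `F > 0` on `[x, y]`. [instance data] -/
theorem e58_pos {lf : Poly} {L : List PLeaf} {x y : ℚ} (hxy : x < y)
    (ht : tiles x (L.map fun l => (l.e, l.k)) y = true)
    (hc : OpModel.trig.pLeavesCheck e58Prm (2 ^ 60) (e58PosProg lf) [] L = true)
    {t : ℝ} (h1 : (x : ℝ) ≤ t) (h2 : t ≤ (y : ℝ)) : 0 < Poly.eval lf t := by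
  obtain ⟨-, h⟩ := OpSem.trig.pos_of_pLeavesCheck (prm := e58Prm) (S := 2 ^ 60) (by norm_num) boxMem_nil L x y ht hc
  have h' := h hxy t ⟨h1, h2⟩
  rwa [toFunP_trig, toFunP_e58PosProg] at h'

/-- Energy domination on a piece `[x, y]` from the two leaf certificates of a polynomial amplitude. [instance data] -/
theorem e58_dominates {lf : Poly} {L : List PLeaf} {x y : ℚ} (hxy : x < y)
    (ht : tiles x (L.map fun l => (l.e, l.k)) y = true)
    (hres : OpModel.trig.pLeavesCheck e58Prm (2 ^ 60) (e58Prog lf (Poly.deriv (Poly.deriv lf))) [] L = true)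
    (hpos : OpModel.trig.pLeavesCheck e58Prm (2 ^ 60) (e58PosProg lf) [] L = true) :
    SAlpha.EnergyDominatesOn 1 (29 / 50) (SAlpha.amplitudePhase 1 (29 / 50) (Poly.eval lf) (Poly.eval (Poly.deriv lf)))
      (Icc (x : ℝ) (y : ℝ)) :=
  SAlpha.energyDominatesOn_of_amplitude (F'' := Poly.eval (Poly.deriv (Poly.deriv lf)))
    (fun θ _ => Poly.hasDerivAt_eval lf θ) (fun θ _ => Poly.hasDerivAt_eval (Poly.deriv lf) θ)
    (Poly.continuous_eval _).continuousOn
    (fun _ hθ => e58_pos hxy ht hpos hθ.1 hθ.2)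
    (fun _ hθ => e58_residual_nonpos hxy ht hres hθ.1 hθ.2)

/-- KERNEL CHECK (residual leaves of piece 0). [instance data] -/
theorem e58_res0_ok : OpModel.trig.pLeavesCheck e58Prm (2 ^ 60) (e58Prog R0 (Poly.deriv (Poly.deriv R0))) [] e58Leaves0 = true := by
  decide +kernel

/-- KERNEL CHECK (positivity leaves of piece 0). [instance data] -/
theorem e58_pos0_ok : OpModel.trig.pLeavesCheck e58Prm (2 ^ 60) (e58PosProg R0) [] e58Leaves0 = true := by
  decide +kernel

/-- The leaves tile `[0, 2]`. [instance data] -/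
theorem e58_tiles0 : tiles (0 : ℚ) (e58Leaves0.map fun l => (l.e, l.k)) (2 : ℚ) = true := by
  decide +kernel

/-- **PIECE 0**: the phase of `F_0` dominates the `s–α` energy on `[0, 2]` at `(s, α) = (1, 29/50)`. [instance data] -/
theorem e58_dominates0 :
    SAlpha.EnergyDominatesOn 1 (29 / 50) (SAlpha.amplitudePhase 1 (29 / 50) (Poly.eval R0) (Poly.eval (Poly.deriv R0)))
      (Icc (0 : ℝ) (2 : ℝ)) := by
  have h := e58_dominates (lf := R0) (x := 0) (y := 2) (by norm_num) e58_tiles0 e58_res0_ok e58_pos0_ok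
  norm_num at h
  exact h

end SAlphaStable58

end Summit.Ventures.FusionMHD.Models
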